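import Summits.CriticalPhenomena.SAWScalingLimit.Theorems.SAWDevelopingMapInteriorFlatteningLiouvilleDefs
import Summits.CriticalPhenomena.SAWScalingLimit.Theorems.SAWDevelopingMapInteriorFlatteningOneMouthSimplyConnected
import Summits.CriticalPhenomena.SAWScalingLimit.Theorems.SAWDevelopingMapInteriorFlatteningOneScaleGlue

/-!
# Uniqueness reduction for `InteriorFlattening` (S7), part A: pictures, picture domains, the topological lemma

Crux `stmt-CriticalPhenomena-8297`
(`Summit.CriticalPhenomena.SAWScalingLimit.Theses.SAWDevelopingMap.InteriorFlattening`), line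
`liouville-local-limits`, registered stub `stub_uniquenessReduction` (S7, lead `c1`). This is the
first of the helper files of the reduction
`LocalLimits.Subsingleton ⇐ PicLimits.Subsingleton ∧ (S4) ∧ (S6) ∧ (S6')` (under bulk no-fold).
It contains the elementary API of the objects of the Defs module
`…SAWDevelopingMapInteriorFlatteningLiouvilleDefs` that the reduction uses, and its one
non-analytic step:

* lattice balls `B_s(O)` (`latticeBall_mono`, the star of `O` lies in `B_1(O)`), the comparison
  sets `innerEdges r` (membership, every edge of `ℍ` lies in some `innerEdges r`, the star of `O`
  lies in all of them for `r ≥ 1`);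
* pictures `P ∈ Pic S` (unpacking), cleanliness is antitone in the radius (`clean_antitone`), the
  picture domain of an `S`-deep configuration is the domain-free one (`picDom_eq`), a clean
  picture domain is deep at `O` (`deep_picDom`), its root dart is a boundary mid-edge
  (`picRoot_mem_boundary`), and a picture whose dart head is an intrusion has identically
  vanishing field (`picField_eq_zero_of_mem`);
* **the topological lemma** (`simplyConnected_of_amp_ne_zero`, `goodPic_of_amp_ne_zero` — the
  registered sub-goal this file carries): a picture REALISED by a prefix (non-zero amplitude
  `amp D ρ S P`) has a simply connected picture domain `B_S(O) ∖ P.1`, because its intrusion set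
  is `B_S(O) ∩ ψ` for a self-avoiding walk `ψ` ending at the dart tail outside the ball, and a
  ball minus a walk reaching outside is simply connected
  (`OneMouth.stub_oneMouthSimplyConnected`); with an unvisited dart head it is GOOD;
* windows: in a `2S`-deep configuration (`S ≥ 1`) the boundary root lies outside `B_S(O)`
  (`root_not_mem_latticeBall`), and the dyadic window of `OneMouth.exists_window` restated for
  the Defs' `Deep`.

Sources: H. Duminil-Copin, S. Smirnov, Ann. of Math. 175 (2012) 1653–1665 (arXiv:1007.0575), §2;
the line card `Cruxes/InteriorFlattening/Lines/liouville-local-limits.md`.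
-/

noncomputable section

open scoped BigOperators Classical Topology
open Filter Literature.Probability.LatticeModels Literature.Probability.RandomPlanarGeometry.SAW

namespace Summit.CriticalPhenomena.SAWScalingLimit.Theorems.InteriorFlattening.Liouville

namespace Reduction

/-! ### Lattice balls around `O` and the star of `O` -/

/-- `latticeBall` is monotone in the radius. -/
theorem latticeBall_mono {s t : ℝ} (h : s ≤ t) : latticeBall s ⊆ latticeBall t := by
  intro w hw
  rw [mem_latticeBall_iff] at hw ⊢
  exact hw.trans h

/-- `O ∈ B_s(O)` for `s ≥ 0`. -/
theorem O_mem_latticeBall {s : ℝ} (h : 0 ≤ s) : O ∈ latticeBall s := by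
  rw [mem_latticeBall_iff, dist_self]
  exact h

/-- `O ∼ A`. -/
theorem adj_O_nbA : hexGraph.Adj O nbA := by
  unfold O nbA
  exact (hexGraph_adj_iff_of_snd_eq_zero_holds 0 0).2 (Or.inl rfl)

/-- `O ∼ B`. -/
theorem adj_O_nbB : hexGraph.Adj O nbB := by
  unfold O nbB
  exact (hexGraph_adj_iff_of_snd_eq_zero_holds 0 _).2 (Or.inr (Or.inl (zero_sub _).symm))

/-- `O ∼ C`. -/
theorem adj_O_nbC : hexGraph.Adj O nbC := by
  unfold O nbC
  exact (hexGraph_adj_iff_of_snd_eq_zero_holds 0 _).2 (Or.inr (Or.inr (zero_sub _).symm))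

/-- A neighbour of `O` lies in `B_s(O)` for `s ≥ 1` (the edge length is `1/√3 ≤ 1`). -/
theorem mem_latticeBall_of_adj_O {w : HexVertex} (hw : hexGraph.Adj O w) {s : ℝ} (hs : 1 ≤ s) :
    w ∈ latticeBall s :=
  mem_latticeBall_iff.2 ((OneMouth.dist_le_one_of_adj hw).trans hs)

/-- `Deep Λ O` is antitone in the radius. -/
theorem deep_anti {Λ : Finset HexVertex} {v : HexVertex} {R R' : ℝ} (h : Deep Λ v R)
    (hle : R' ≤ R) : Deep Λ v R' :=
  fun w hw => h w (hw.trans hle)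

/-- Deep at `O` at radius `R` ⇒ the smaller lattice balls lie in the domain. -/
theorem mem_of_deep {Λ : Finset HexVertex} {R r : ℝ} (hd : Deep Λ O R) (hr : r ≤ R)
    {p : HexVertex} (hp : p ∈ latticeBall r) : p ∈ Λ :=
  hd p ((mem_latticeBall_iff.1 hp).trans hr)

/-- The monopole at `O` is the sum over the three star edges (unfolding). -/
theorem obsMono_eq (Λ : Finset HexVertex) (a : Sym2 HexVertex) :
    obsMono Λ a = obs Λ a s(O, nbA) + obs Λ a s(O, nbB) + obs Λ a s(O, nbC) := rfl

/-- The picture monopole is the sum of the picture field over the three star edges. -/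
theorem picMono_eq (S : ℝ) (P : Picture) :
    picMono S P = picField S P s(O, nbA) + picField S P s(O, nbB) + picField S P s(O, nbC) := rfl

/-! ### The comparison sets `innerEdges r` -/

/-- Membership in `innerEdges r`. -/
theorem mk_mem_innerEdges {r : ℝ} {p q : HexVertex} (hp : p ∈ latticeBall r)
    (hq : q ∈ latticeBall r) (h : hexGraph.Adj p q) : s(p, q) ∈ innerEdges r :=
  Finset.mem_image.2 ⟨(p, q), Finset.mem_filter.2 ⟨Finset.mk_mem_product hp hq, h⟩, rfl⟩

/-- Elements of `innerEdges r` are pairs `s(p, q)` of adjacent vertices of `B_r(O)`. -/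
theorem exists_of_mem_innerEdges {r : ℝ} {e : Sym2 HexVertex} (he : e ∈ innerEdges r) :
    ∃ p q : HexVertex, e = s(p, q) ∧ p ∈ latticeBall r ∧ q ∈ latticeBall r ∧ hexGraph.Adj p q := by
  obtain ⟨pq, hpq, rfl⟩ := Finset.mem_image.1 he
  obtain ⟨hmem, hadj⟩ := Finset.mem_filter.1 hpq
  obtain ⟨hp, hq⟩ := Finset.mem_product.1 hmem
  exact ⟨pq.1, pq.2, rfl, hp, hq, hadj⟩

/-- `innerEdges r ⊆ E(ℍ)`. -/
theorem mem_edgeSet_of_mem_innerEdges {r : ℝ} {e : Sym2 HexVertex} (he : e ∈ innerEdges r) :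
    e ∈ hexGraph.edgeSet := by
  obtain ⟨p, q, rfl, -, -, h⟩ := exists_of_mem_innerEdges he
  exact (SimpleGraph.mem_edgeSet _).2 h

/-- `innerEdges` is monotone in the radius. -/
theorem innerEdges_mono {r r' : ℝ} (h : r ≤ r') : innerEdges r ⊆ innerEdges r' := by
  intro e he
  obtain ⟨p, q, rfl, hp, hq, hadj⟩ := exists_of_mem_innerEdges he
  exact mk_mem_innerEdges (latticeBall_mono h hp) (latticeBall_mono h hq) hadj

/-- The star of `O` lies in `innerEdges r` for `r ≥ 1`. -/
theorem star_mem_innerEdges {r : ℝ} (hr : 1 ≤ r) {w : HexVertex} (hw : hexGraph.Adj O w) :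
    s(O, w) ∈ innerEdges r :=
  mk_mem_innerEdges (O_mem_latticeBall (zero_le_one.trans hr)) (mem_latticeBall_of_adj_O hw hr) hw

/-- Every edge of `ℍ` lies in `innerEdges r` for some `r ≥ 1`. -/
theorem exists_mem_innerEdges {z : Sym2 HexVertex} (hz : z ∈ hexGraph.edgeSet) :
    ∃ r : ℝ, 1 ≤ r ∧ z ∈ innerEdges r := by
  induction z using Sym2.ind with
  | h p q =>
    have h : hexGraph.Adj p q := (SimpleGraph.mem_edgeSet _).1 hz
    refine ⟨max 1 (max (dist (hexCenter p) (hexCenter O)) (dist (hexCenter q) (hexCenter O))),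
      le_max_left _ _, ?_⟩
    exact mk_mem_innerEdges
      (mem_latticeBall_iff.2 ((le_max_left _ _).trans (le_max_right _ _)))
      (mem_latticeBall_iff.2 ((le_max_right _ _).trans (le_max_right _ _))) h

/-! ### Pictures and picture domains -/

/-- Unpacking `P ∈ Pic S`: intrusions inside `B_S(O)`, dart tail in `B_{S+1}(O) ∖ B_S(O)`, dart
head in `B_S(O)`, tail and head adjacent. -/
theorem of_mem_Pic {S : ℝ} {P : Picture} (hP : P ∈ Pic S) :
    P.1 ⊆ latticeBall S ∧ P.2.1 ∈ latticeBall (S + 1) ∧ P.2.1 ∉ latticeBall S ∧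
      P.2.2 ∈ latticeBall S ∧ hexGraph.Adj P.2.1 P.2.2 := by
  unfold Pic darts at hP
  simp only [Finset.mem_product, Finset.mem_powerset, Finset.mem_filter, Finset.mem_sdiff] at hP
  obtain ⟨h1, ⟨⟨h21, h21'⟩, h22⟩, hadj⟩ := hP
  exact ⟨h1, h21, h21', h22, hadj⟩

/-- `Clean` is antitone in the cleanliness radius. -/
theorem clean_antitone {s t : ℝ} (h : s ≤ t) {P : Picture} (hc : Clean t P) : Clean s P :=
  Disjoint.mono_right (latticeBall_mono h) hc

/-- For an `S`-deep domain `D` the picture domain inside `D` is the domain-free one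
`B_S(O) ∖ P.1`. -/
theorem picDom_eq {D : Finset HexVertex} {S : ℝ} (h : latticeBall S ⊆ D) (P : Picture) :
    picDom D S P = latticeBall S \ P.1 := by
  unfold picDom
  rw [Finset.inter_eq_right.2 h]

/-- A clean picture domain is deep at `O`: `Clean s̄ P` and `s̄ ≤ S` give
`Deep (B_S(O) ∖ P.1) O s̄`. -/
theorem deep_picDom {S sbar : ℝ} {P : Picture} (hc : Clean sbar P) (hle : sbar ≤ S) :
    Deep (latticeBall S \ P.1) O sbar := by
  intro w hw
  have hws : w ∈ latticeBall sbar := mem_latticeBall_iff.2 hw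
  exact Finset.mem_sdiff.2 ⟨latticeBall_mono hle hws, fun hwP => Finset.disjoint_left.1 hc hwP hws⟩

/-- The root dart of a picture whose head is not an intrusion is a boundary mid-edge of its
picture domain. -/
theorem picRoot_mem_boundary {S : ℝ} {P : Picture} (hP : P ∈ Pic S) (h2 : P.2.2 ∉ P.1) :
    picRoot P ∈ hexDomainBoundary (latticeBall S \ P.1) := by
  obtain ⟨-, -, hy, hz, hadj⟩ := of_mem_Pic hP
  refine ⟨(SimpleGraph.mem_edgeSet _).2 hadj, P.2.1, P.2.2, rfl, Finset.mem_sdiff.2 ⟨hz, h2⟩, ?_⟩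
  exact fun h => hy (Finset.mem_sdiff.1 h).1

/-- If the dart head is an intrusion the picture field vanishes identically (its root is not a
mid-edge of the picture domain). -/
theorem picField_eq_zero_of_mem {S : ℝ} {P : Picture} (hP : P ∈ Pic S) (h2 : P.2.2 ∈ P.1)
    (z : Sym2 HexVertex) : picField S P z = 0 := by
  obtain ⟨-, -, hy, -, -⟩ := of_mem_Pic hP
  refine hexParafermionicObservable_eq_zero_of_not_mem ?_ _ _ _
  rintro ⟨-, t, ht, htD⟩
  rcases Sym2.mem_iff.1 ht with h | h
  · exact hy (h ▸ (Finset.mem_sdiff.1 htD).1)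
  · exact (Finset.mem_sdiff.1 htD).2 (h ▸ h2)

/-- … and so does its monopole. -/
theorem picMono_eq_zero_of_mem {S : ℝ} {P : Picture} (hP : P ∈ Pic S) (h2 : P.2.2 ∈ P.1) :
    picMono S P = 0 := by
  rw [picMono_eq, picField_eq_zero_of_mem hP h2, picField_eq_zero_of_mem hP h2,
    picField_eq_zero_of_mem hP h2, add_zero, add_zero]

/-! ### The topological lemma -/

/-- **Topological lemma.** A picture realised by a prefix — non-zero amplitude `amp D ρ S P` —
has a simply connected picture domain `B_S(O) ∖ P.1`: the intrusion set is `ψ ∩ B_S(O)` for a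
self-avoiding walk `ψ` whose last vertex is the dart tail, outside the ball. -/
theorem simplyConnected_of_amp_ne_zero {D : Finset HexVertex} {ρ : Sym2 HexVertex} {S : ℝ}
    {P : Picture} (hP : P ∈ Pic S) (h : amp D ρ S P ≠ 0) :
    hexDomainSimplyConnected (latticeBall S \ P.1) := by
  obtain ⟨-, -, hy, -, -⟩ := of_mem_Pic hP
  obtain ⟨ψ, -, hψ⟩ := Finset.exists_ne_zero_of_sum_ne_zero h
  have hc : ψ.verts.getLast? = some P.2.1 ∧ ψ.verts.toFinset ∩ latticeBall S = P.1 := by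
    by_contra hc
    exact hψ (if_neg hc)
  obtain ⟨hlast, hint⟩ := hc
  have heq : latticeBall S \ P.1 = latticeBall S \ ψ.verts.toFinset := by
    rw [← hint, Finset.sdiff_inter_self_right]
  rw [heq]
  exact OneMouth.stub_oneMouthSimplyConnected O S (latticeBall S) (fun w => mem_latticeBall_iff) D ρ
    (picRoot P) ψ ⟨P.2.1, List.mem_of_getLast? hlast, hy⟩

/-- **Realised pictures with unvisited dart head are good** (registered sub-goal of the crux,
carried by this file): simply connected picture domain by the topological lemma, and the head
is not an intrusion by hypothesis. -/
theorem goodPic_of_amp_ne_zero :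
    ∀ (D : Finset HexVertex) (ρ : Sym2 HexVertex) (S : ℝ) (P : Picture),
      P ∈ Pic S → amp D ρ S P ≠ 0 → P.2.2 ∉ P.1 → GoodPic S P := by
  intro D ρ S P hP h h2
  exact ⟨simplyConnected_of_amp_ne_zero hP h, h2⟩

/-! ### Windows -/

/-- In a `2S`-deep configuration with `S ≥ 1` both endpoints of a boundary root lie outside
`B_S(O)` (one is outside `Λ ⊇ B_{2S}(O)`, the other is adjacent to it). -/
theorem root_not_mem_latticeBall {Λ : Finset HexVertex} {a : Sym2 HexVertex} {S : ℝ}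
    (ha : a ∈ hexDomainBoundary Λ) (hd : Deep Λ O (2 * S)) (hS : 1 ≤ S) :
    ∀ u ∈ a, u ∉ latticeBall S := by
  obtain ⟨hedge, u, v, rfl, -, hu⟩ := ha
  have hadj : hexGraph.Adj u v := (SimpleGraph.mem_edgeSet _).1 hedge
  have hfar : 2 * S < dist (hexCenter u) (hexCenter O) := not_le.1 fun h => hu (hd u h)
  have h1 : dist (hexCenter u) (hexCenter v) ≤ 1 := by
    rw [dist_comm]
    exact OneMouth.dist_le_one_of_adj hadj
  intro x hx hxS
  rw [mem_latticeBall_iff] at hxS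
  rcases Sym2.mem_iff.1 hx with h | h
  · rw [h] at hxS
    linarith
  · rw [h] at hxS
    have := dist_triangle (hexCenter u) (hexCenter v) (hexCenter O)
    linarith

/-- The dyadic window of `OneMouth.exists_window`, for the Defs' `Deep`: a `2r₀`-deep
configuration (`r₀ > 0`) has a scale `S ≥ r₀` with `B_{2S}(O) ⊆ Λ ⊉ B_{4S}(O)`. -/
theorem exists_windowScale {Λ : Finset HexVertex} {r₀ : ℝ} (h₀ : 0 < r₀) (h : Deep Λ O (2 * r₀)) :
    ∃ S : ℝ, r₀ ≤ S ∧ Deep Λ O (2 * S) ∧ ¬ Deep Λ O (4 * S) :=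
  OneMouth.exists_window Λ O r₀ h₀ h

/-- **Admissibility of clean good picture domains.** For `P ∈ Pic S` good and `s̄`-clean with
`s̄ ≤ S`, the picture domain `B_S(O) ∖ P.1` is simply connected, rooted at the boundary dart
`picRoot P`, and `O` is `s̄`-deep in it. -/
theorem picDom_admissible {S sbar : ℝ} {P : Picture} (hP : P ∈ Pic S) (hg : GoodPic S P)
    (hc : Clean sbar P) (hle : sbar ≤ S) :
    hexDomainSimplyConnected (latticeBall S \ P.1) ∧
      picRoot P ∈ hexDomainBoundary (latticeBall S \ P.1) ∧ Deep (latticeBall S \ P.1) O sbar :=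
  ⟨hg.1, picRoot_mem_boundary hP hg.2, deep_picDom hc hle⟩

end Reduction

end Summit.CriticalPhenomena.SAWScalingLimit.Theorems.InteriorFlattening.Liouville

end
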